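import Summits.ResolutionOfSingularities.ResolutionOfSingularities.Theorems.WeightedInvariantLocalWeightedDropTrackCFrames
import Summits.ResolutionOfSingularities.ResolutionOfSingularities.Theorems.WeightedInvariantLocalWeightedDropTrackCChartPoint
import Literature.AlgebraicGeometry.Resolution.BlowupChartRsop
import Literature.AlgebraicGeometry.Resolution.BlowupReducedDimension
import Literature.AlgebraicGeometry.Resolution.FormalBranchesLocal

/-!
# Track C, the blow-up step AT the centre (ii): the chart ring map and the frame at the new point

[OURS · L1 W4.3 · chain w43, stub worker 4] Helper for TRACK C of the engine crux `LocalWeightedDrop`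
(stmt-ResolutionOfSingularities-8899; skeleton `L/res-L1-w43-stub-4/TrackC_Skeleton.lean`, lemma L2, in-centre case).
NOT a statement of any manuscript.

Setting: a framed point `z` of `Z'` with frame `F` ADAPTED to a regular system of parameters `x₀,x₁,x₂` of `𝒪_{Z',z}`
(`F.e xₗ = Xₗ`), a centre `C` with `C_z = (x_l : l < n)`, and successor data of the game's weight-`𝟙_{l<n}` move: an
exceptional point `c : Fin 3 → k` (zero off the centre coordinates) and a chart index `i < n` with `cᵢ ≠ 0`. The
TRANSLATED generators `u'_l = x_l − (c_l/cᵢ) xᵢ` (`l ≠ i`), `u'ᵢ = xᵢ` present the Rees chart `B = 𝒪_{Z',z}[C_z/xᵢ]`;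
the RESTRICTED CHART substitution `ρ_l = s·(c_l + y_l)` (`l < n`, `l ≠ i`), `ρᵢ = s·cᵢ`, `ρ_l = y_l` (`l ≥ n`) of the game
(`SliceChart.subst_restrictedChart`) defines `θ = ρ^* ∘ F : 𝒪_{Z',z} → k⟦s,y⟧`, under which `θ(u'_l) = θ(xᵢ)·(y_l/cᵢ)`:
* `exists_chartHom` — the ring map `χ : B → k⟦s,y⟧` over `θ` with `χ(u'_l/xᵢ) = y_l/cᵢ`, whose pull-back of the
  maximal ideal lies over `𝔪_z` (this prime `𝔴` of `B` is the point of the blow-up chosen by the Refuter);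
* `exists_frame_square` — at the point `x' ∈ Z''` of the blow-up with `𝒪_{Z'',x'} = B_𝔴` (`exists_point_of_chart`): a
  Cohen frame `F''` (the local ring is regular of dimension `3` with residue field `k` and regular system of parameters
  `(xᵢ/cᵢ, cᵢ·u'_l/xᵢ, x_m)`, by the tree's `isRsopPart_chartFamily_reesChart` and `dim 𝒪_{Z'',x'} ≤ dim 𝒪_{Z',z}`) in
  which THE COMPLETED STALK MAP IS THE RESTRICTED CHART: `F''(τ̂♯ a) = ρ^*(F a)` (`ringEquiv_map_eq_subst`).
-/

noncomputable section

open CategoryTheory CategoryTheory.Limits AlgebraicGeometry TopologicalSpace IsLocalRing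
open Literature.AlgebraicGeometry.Resolution
open Literature.RingTheory.MvPowerSeries.Jets
open Scheme.IdealSheafData

set_option linter.dupNamespace false -- mandated namespace of this single-conjunct summit

namespace Summit.ResolutionOfSingularities.ResolutionOfSingularities.Theorems.TrackC

variable {k : Type} [Field k]

namespace Frame

variable {Z : Scheme.{0}} {σ : Z ⟶ Spec (.of (MvPowerSeries (Fin 3) k))} {z : Z}
  [hN : IsNoetherianRing (Z.presheaf.stalk z)]

/-- Membership in the maximal ideal is read off the constant term in a frame. [OURS · folklore] -/
theorem mem_maximalIdeal_iff (F : Frame σ z) (r : Z.presheaf.stalk z) :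
    r ∈ maximalIdeal (Z.presheaf.stalk z) ↔ MvPowerSeries.constantCoeff (F.e (algebraMap _ _ r)) = 0 := by
  rw [← mem_maximalIdeal_iff_constantCoeff_eq_zero, IsLocalRing.mem_maximalIdeal, IsLocalRing.mem_maximalIdeal,
    ← map_mem_nonunits_iff (algebraMap (Z.presheaf.stalk z)
      (AdicCompletion (maximalIdeal (Z.presheaf.stalk z)) (Z.presheaf.stalk z))) r,
    mem_nonunits_iff, mem_nonunits_iff]
  exact (MulEquiv.isUnit_map F.e.toMulEquiv).symm.not

end Frame

/-! ## The restricted chart substitution -/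

section Rho

variable (cv : Fin 3 → k) (i' : Fin 3) (n : ℕ)

/-- The components of the restricted chart have no constant term (given `c_l = 0` for `l ≥ n`).
[OURS · folklore] -/
theorem constantCoeff_rchart (hcv : ∀ l : Fin 3, n ≤ (l : ℕ) → cv l = 0) (l : Fin 3) :
    MvPowerSeries.constantCoeff ((fun l : Fin 3 => (MvPowerSeries.X 0 : MvPowerSeries (Fin 3) k) ^
      (if (l : ℕ) < n then 1 else 0) * (MvPowerSeries.C (cv l) +
        if l = i' then (0 : MvPowerSeries (Fin 3) k) else MvPowerSeries.X (Fin.predAbove i' l.succ))) l) = 0 := by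
  by_cases hl : (l : ℕ) < n
  · simp [hl]
  · have h0 : cv l = 0 := hcv l (not_lt.mp hl)
    by_cases hli : l = i'
    · subst hli
      simp [hl, h0]
    · simp [hl, h0, hli]

end Rho

/-! ## The chart ring map at the framed point -/

section ChartHom

variable {Z : Scheme.{0}} {σ : Z ⟶ Spec (.of (MvPowerSeries (Fin 3) k))} {z : Z}
  [hN : IsNoetherianRing (Z.presheaf.stalk z)]

/-- **The Rees chart ring over `k⟦s,y⟧` through the restricted chart.** With `θ = ρ^* ∘ F` (`F` a frame adapted to
the regular system of parameters `x`, `ρ` the restricted chart substitution at the exceptional point `c` on the chart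
`i`), the translated generators `u'` of the centre satisfy `θ(u'_l) = θ(xᵢ) · (y_l / cᵢ)`, so `θ` extends to the Rees
chart ring `B = 𝒪[C_z/xᵢ]`; the maximal ideal of `k⟦s,y⟧` pulls back to `𝔪_z`. [OURS · folklore] -/
theorem exists_chartHom (F : Frame σ z) (x : Fin 3 → Z.presheaf.stalk z)
    (hx : ∀ l, F.e (algebraMap _ _ (x l)) = MvPowerSeries.X l) {n : ℕ} (hn3 : n ≤ 3)
    (cv : Fin 3 → k) (iN : Fin n) (hci : cv (Fin.castLE hn3 iN) ≠ 0)
    (hcv : ∀ l : Fin 3, n ≤ (l : ℕ) → cv l = 0)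
    (u' : Fin n → Z.presheaf.stalk z) (hu'i : u' iN = x (Fin.castLE hn3 iN))
    (hu'l : ∀ l, l ≠ iN → u' l = x (Fin.castLE hn3 l) -
      stalkConst σ z (cv (Fin.castLE hn3 l) / cv (Fin.castLE hn3 iN)) * x (Fin.castLE hn3 iN)) :
    ∃ χ : chartRing u' iN →+* MvPowerSeries (Fin 3) k,
      (∀ r, χ (chartBase u' iN r) = MvPowerSeries.subst (fun l : Fin 3 =>
        (MvPowerSeries.X 0 : MvPowerSeries (Fin 3) k) ^ (if (l : ℕ) < n then 1 else 0) *
          (MvPowerSeries.C (cv l) + if l = Fin.castLE hn3 iN then (0 : MvPowerSeries (Fin 3) k)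
            else MvPowerSeries.X (Fin.predAbove (Fin.castLE hn3 iN) l.succ))) (F.e (algebraMap _ _ r))) ∧
      (∀ l, l ≠ iN → χ (chartGen u' iN l) =
        MvPowerSeries.C (cv (Fin.castLE hn3 iN))⁻¹ * MvPowerSeries.X (Fin.predAbove (Fin.castLE hn3 iN)
          (Fin.castLE hn3 l).succ)) ∧
      Ideal.comap (χ.comp (chartBase u' iN)) (maximalIdeal (MvPowerSeries (Fin 3) k)) =
        maximalIdeal (Z.presheaf.stalk z) := by
  set i' := Fin.castLE hn3 iN with hi'
  set ρ : Fin 3 → MvPowerSeries (Fin 3) k := fun l : Fin 3 =>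
    (MvPowerSeries.X 0 : MvPowerSeries (Fin 3) k) ^ (if (l : ℕ) < n then 1 else 0) *
      (MvPowerSeries.C (cv l) + if l = i' then (0 : MvPowerSeries (Fin 3) k)
        else MvPowerSeries.X (Fin.predAbove i' l.succ)) with hρ
  have hρ0 : ∀ l, MvPowerSeries.constantCoeff (ρ l) = 0 := constantCoeff_rchart cv i' n hcv
  have hρs : MvPowerSeries.HasSubst ρ := MvPowerSeries.hasSubst_of_constantCoeff_zero hρ0
  -- `θ = ρ^* ∘ F ∘ (𝒪 → 𝒪̂)`
  let θ : Z.presheaf.stalk z →+* MvPowerSeries (Fin 3) k :=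
    ((MvPowerSeries.substAlgHom (R := k) hρs).toRingHom.comp F.e.toRingHom).comp (algebraMap _ _)
  have hθ : ∀ r, θ r = MvPowerSeries.subst ρ (F.e (algebraMap _ _ r)) := fun r => by
    simp [θ]
  have hθx : ∀ l, θ (x l) = ρ l := fun l => by rw [hθ, hx, MvPowerSeries.subst_X hρs]
  have hθc : ∀ a, θ (stalkConst σ z a) = MvPowerSeries.C a := fun a => by
    rw [hθ, F.map_const]
    exact MvPowerSeries.subst_C (a := ρ) a
  have hi'lt : ((i' : Fin 3) : ℕ) < n := by simp [hi']
  have hρi : ρ i' = MvPowerSeries.X 0 * MvPowerSeries.C (cv i') := by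
    simp [hρ, hi'lt]
  -- the quotients `d_l`
  set d : Fin n → MvPowerSeries (Fin 3) k := fun l => if l = iN then 1 else
    MvPowerSeries.C (cv i')⁻¹ * MvPowerSeries.X (Fin.predAbove i' (Fin.castLE hn3 l).succ) with hd
  have hθi : θ (u' iN) = MvPowerSeries.X 0 * MvPowerSeries.C (cv i') := by rw [hu'i, hθx, hρi]
  haveI : IsDomain (MvPowerSeries (Fin 3) k) := NoZeroDivisors.to_isDomain _
  have hCne : (MvPowerSeries.C (cv i') : MvPowerSeries (Fin 3) k) ≠ 0 := fun h =>
    hci (by simpa using congrArg MvPowerSeries.constantCoeff h)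
  have hθne : θ (u' iN) ≠ 0 := by
    rw [hθi]
    exact mul_ne_zero (MvPowerSeries.X_ne_zero_of_field 0) hCne
  have hdl : ∀ l, θ (u' l) = θ (u' iN) * d l := by
    intro l
    by_cases hl : l = iN
    · subst hl; simp [hd]
    · have hne : Fin.castLE hn3 l ≠ i' := fun h => hl (Fin.castLE_injective hn3 (by rw [h, hi']))
      have hllt : ((Fin.castLE hn3 l : Fin 3) : ℕ) < n := by simp
      rw [hu'l l hl, map_sub, map_mul, hθx, hθx, hθc, hθi, hρi]
      simp only [hρ, hllt, if_true, pow_one, hne, if_false, hd, hl]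
      have e1 : (MvPowerSeries.C (cv (Fin.castLE hn3 l) / cv i') : MvPowerSeries (Fin 3) k) *
          (MvPowerSeries.X 0 * MvPowerSeries.C (cv i')) =
          MvPowerSeries.X 0 * MvPowerSeries.C (cv (Fin.castLE hn3 l)) := by
        rw [mul_left_comm, ← map_mul, div_mul_cancel₀ _ hci]
      have e2 : MvPowerSeries.X 0 * MvPowerSeries.C (cv i') * ((MvPowerSeries.C (cv i')⁻¹ : MvPowerSeries (Fin 3) k) *
          MvPowerSeries.X (Fin.predAbove i' (Fin.castLE hn3 l).succ)) =
          MvPowerSeries.X 0 * MvPowerSeries.X (Fin.predAbove i' (Fin.castLE hn3 l).succ) := by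
        rw [mul_assoc, ← mul_assoc (MvPowerSeries.C (cv i')), ← map_mul, mul_inv_cancel₀ hci, map_one, one_mul]
      rw [e1, e2]
      ring
  obtain ⟨χ, hχb, hχe⟩ := exists_chartRing_hom u' iN θ hθne d hdl
  refine ⟨χ, fun r => by rw [hχb, hθ], fun l hl => by rw [hχe]; simp [hd, hl], ?_⟩
  -- the maximal ideal pulls back to `𝔪_z`
  ext r
  rw [Ideal.mem_comap, RingHom.comp_apply, hχb, mem_maximalIdeal_iff_constantCoeff_eq_zero, hθ,
    constantCoeff_subst_of_constantCoeff_zero ρ hρ0, ← F.mem_maximalIdeal_iff]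

end ChartHom

end Summit.ResolutionOfSingularities.ResolutionOfSingularities.Theorems.TrackC

end
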